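import Literature.AlgebraicGeometry.Motives.IntegralModelRestrictScalarsSpecialPoint   -- ★ `reductionAt_point_ext`, sheets (`sheetModelOf`, `genericSheet`, `toSheetScheme`)
import Literature.AlgebraicGeometry.Motives.IntegralModelSheetStructureStage         -- ★ (GS-3a) `exists_stage_sheetStructure_thickening` (the shape of `h`, `hgen`)
import Literature.AlgebraicGeometry.Motives.IntegralModelLocaliseProperties          -- ★ `isProper_localise_total_hom`
import Literature.AlgebraicGeometry.AbelianSchemes.PELTupleStageLocalise             -- ★ (GS-2-core) `towerLeftIso_hom_comp_whiskerLeft_left`, `whiskerLeft_left_comp_whiskerLeft_left_eq_leg`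
import Literature.AlgebraicGeometry.Limits.WhiskerLeftMonoHomPointInjective            -- ★ (G3, LA4-p03) `whiskerLeft_left_comp_injective_of_isLocalization`
import HarnessLib

/-!
# Special points of a localised global model READ THROUGH A STAGE SHEET STRUCTURE: one reading `y ↦ red (ℓ_e y)` lies over ONE
# `𝓞 Fᵢ`-structure, centred on a nonzero prime above `w`; special points are recovered from the stage (organ G4 of the `stub_INJ0` zip)

Topic `Literature/AlgebraicGeometry/Motives`; namespace `Literature.AlgebraicGeometry.Motives.IntegralModel`.  THEOREMS ONLY (no definition,
no instance, no notation, no named fact, no `sorry`).  Cell `hodgecm-mathlib` (D-0151), P6 «MOD programme» (crux hLiu418 = stmt-HodgeConjecture-24832,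
`--supports`, count-neutral); P-LINE ED. 2 leaf `Lines/F0_P6a_PELSpread.lean`, socket `stub_INJ0` in the STAGE CUT (LEAD F0P6-plan (g3) «M-55b» (2);
desk leaf cand v4b letter `RecordInj0OfStageCofinal`; «L4» LA4-p03 (g0) census 2026-09-02T02:42Z gaps **G4** «reading of the special points through the
stage sheet structure» ; G3 is ★ LA4-p03 `WhiskerLeftMonoHomPointInjective`).  HC_CM is proved only modulo the printed citations until rung 0
closes; nothing here is about HC.

THE MATHEMATICS ([SerreTate1968] §1 «reduction map»; [EGAIV3] Thm. 8.8.2 (i); [GortzWedhorn2020] Prop. 4.16, §(4.8), (14.20), Prop. 3.26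
(monomorphisms of schemes), Cor. 10.64 (2); [Hartshorne1977] II Thm. 3.3, II.4.7; [MumfordFogartyKirwan1994] Ch. 7 §2 Def. 7.2: Mumford's moduli functor is a
functor on SCHEMES OVER THE BASE, so fine-moduli injectivity separates only points with the SAME base structure).  Let `F ⊆ Fᵢ` be number fields,
`X∕F` a scheme and `𝒳` a GLOBAL integral model over `𝓞 F` of the Galois thickening `X ⊗_F Fᵢ` regarded over `F` (the P-LINE's `𝓜`, BY VALUE — not a
restriction of scalars, so ★ `specialSheet_eq_iff` does not apply).  By ★ (GS-3a) the sheet structure `X ⊗_F Fᵢ → Spec Fᵢ` spreads to a STAGE: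
`h : 𝒳 ⊗ D(t) → Spec 𝓞 Fᵢ ⊗ D(t)` over `D(t) = Spec 𝓞 F[1∕t]` with prescribed generic value (`hgen`).  At a prime `w` reaching the stage
(`τ : Spec 𝒪_{F,(w)} → D(t)` over `Spec 𝓞 F`) the localised model `𝓨 := 𝒳.localise w = 𝒳 ⊗ Spec 𝒪_{F,(w)}` maps to the stage by the LOCALISATION LEG
`𝒳 ◁ τ` (the desk's `stageLocLeg`), and the composite `σ := (𝒳 ◁ τ) ≫ h ≫ pr₁ : 𝓨 → Spec 𝓞 Fᵢ` is an `𝓞 Fᵢ`-structure on `𝓨` whose generic value is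
the sheet coordinate.  §1: for ANY morphism `s` of localised models from `𝓨` to the localised SHEET MODEL `Spec B ⊗ 𝒪_{F,(w)}` (★ `sheetModelOf`) with
that generic value, the reduction map intertwines `s` with the sheet of the generic point (★ `geomReductionMap_map` = [SerreTate1968] §1 + valuative
criterion), and the generic sheet of `ℓ_e y` is `e` for every `y` (★ `embOfPoint_thickeningLift`) — so ALL special points `red_𝓨 (ℓ_e y)` of ONE reading
have the SAME image under `s_s` (`map_specialFibre_geomReductionMap_thickeningLift_eq`).  §2: `σ` IS such an `s` (paired with the projection to
`Spec 𝒪_{F,(w)}`; its generic square is checked against the two projections of `Spec Fᵢ = Spec 𝓞 Fᵢ ×_{𝓞 F} Spec F`, ★ `isPullback_specMap_of_isPushout`,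
using ★ (GS-2-core) `towerLeftIso ≫ (𝒳 ◁ κ) ≫ (𝒳 ◁ τ) = pr ≫ (𝒳 ◁ τ)` with `(𝒳 ◁ κ) ≫ (𝒳 ◁ τ) = 𝒳 ◁ leg_t`).  §3 HEAD
`specialPoint_stageSheet_eq`: the two special points `x̄ᵢ := red_𝓨 (ℓ_e yᵢ)` have the SAME composite `x̄ᵢ ≫ ι_s ≫ (𝒳 ◁ τ) ≫ h ≫ pr₁ : Spec κ̄(w) → Spec 𝓞 Fᵢ`
— the «same structure map» hypothesis of ★ (GS-3) `exists_finset_forall_eq_of_tupleIsoAt` for the stage family read PER SHEET.  §4: that composite is CENTRED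
on a NONZERO prime `v` of `𝓞 Fᵢ` above `w` (its composite to `Spec 𝓞 F` is `Spec κ̄(w) → Spec κ(w) → Spec 𝒪_{F,(w)} → Spec 𝓞 F`, kernel `w`;
`exists_heightOneSpectrum_center_specialPoint_stageSheet`) — the `v ∉ S` slot of ★ (GS-3).  §5: equal images of `spPt x̄ᵢ` in the stage give `x̄₁ = x̄₂` (★ (G3, LA4-p03) `whiskerLeft_left_comp_injective_of_isLocalization`
+ ★ `reductionAt_point_ext`; `reductionAt_point_eq_of_comp_whiskerLeft_eq`).

CONSUMER (the `stub_INJ0` zip): with `q := h.left ≫ pr₁` on `𝒱 ⊆ 𝒳 ⊗ D(t)`, the points `spPt x̄ᵢ ≫ stageLocLeg` satisfy `z₁ ≫ q = z₂ ≫ q` (§3) centred over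
`v ∉ S` (§4); ★ (GS-3) gives `z₁ = z₂`, §5 gives `x̄₁ = x̄₂`.

## References
* [SerreTate1968] J.-P. Serre, J. Tate, *Good reduction of abelian varieties*, Ann. of Math. 88 (1968), §1 (models over `𝒪_(v)`, the reduction map).
* [EGAIV3] A. Grothendieck, J. Dieudonné, *ÉGA* IV₃, Publ. Math. IHÉS 28 (1966), Thm. 8.8.2 (i) (p. 28).
* [GortzWedhorn2020] U. Görtz, T. Wedhorn, *Algebraic Geometry I*, 2nd ed. (2020), Prop. 4.16 and §(4.8), (14.20), Cor. 10.64 (2) (p. 329).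
* [Hartshorne1977] R. Hartshorne, *Algebraic Geometry* (1977), II Thm. 3.3 (p. 87), II Thm. 4.7 (p. 101).
* [MumfordFogartyKirwan1994] D. Mumford, J. Fogarty, F. Kirwan, *Geometric Invariant Theory*, 3rd ed. (1994), Ch. 7 §2 Def. 7.2 (p. 129).
-/

set_option autoImplicit false

noncomputable section

-- Mathlib's `Over`/pull-back API is stated across semireducible wrappers (as in the ★ `Motives/IntegralModel*` and `AbelianSchemes/*` stage files).
set_option backward.isDefEq.respectTransparency false

open CategoryTheory CategoryTheory.Limits AlgebraicGeometry IsDedekindDomain IsDedekindDomain.HeightOneSpectrum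
open MonoidalCategory CartesianMonoidalCategory
open scoped NumberField nonZeroDivisors
open Literature.NumberTheory.EllipticCurves (genericFibre specGenericPoint)
open Literature.NumberTheory.DiophantineGeometry (geomResidueField specialFibreFunctor specResidueField)
open Literature.AlgebraicGeometry.Limits.LocApprox (Idx baseDiagram leg)
open Literature.AlgebraicGeometry.AbelianSchemes (towerLeftIso_hom_comp_whiskerLeft_left whiskerLeft_left_comp_whiskerLeft_left_eq_leg)

namespace Literature.AlgebraicGeometry.Motives.IntegralModel

/-! ### §1 Any morphism of localised models to the sheet model with the sheet coordinate as generic value: one reading, one special sheet -/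

section Abstract

variable {F Fi : Type} [Field F] [NumberField F] [Field Fi] [NumberField Fi] [Algebra F Fi]
  {B : Type} [CommRing B] [Algebra (𝓞 Fi) B] [Algebra B Fi] [IsScalarTower (𝓞 Fi) B Fi]
  [Algebra (𝓞 F) B] [IsScalarTower (𝓞 F) B Fi]
  (hinj : Function.Injective (algebraMap B Fi)) (X : SchemeOver F)
  (𝒳 : IntegralModel (𝓞 F) F ((thickening F Fi).obj X)) (w : HeightOneSpectrum (𝓞 F))

/-- **ONE READING ↦ ONE SPECIAL SHEET, for any sheet-valued model morphism.**  Let `s : 𝓨 → Spec B ⊗ 𝒪_{F,(w)}` be a morphism of localised models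
(`𝓨 = 𝒳.localise w`, target the localised ★ sheet model of `B`) whose generic value through the two `genericIso′` is the sheet coordinate
`X ⊗_F Fᵢ → Spec Fᵢ` regarded over `F` (★ `toSheetScheme`).  Then for every `F`-embedding `e : Fᵢ → Ω̄_w` and all `y₁, y₂ ∈ X(Ω̄_w)` the special points
`red_𝓨 (ℓ_e y₁)`, `red_𝓨 (ℓ_e y₂)` have the SAME image under the special fibre `s_s` of `s`: both are the reduction, in the sheet model, of the generic
sheet of `e` (★ `geomReductionMap_map`; ★ `embOfPoint_genericSheet`, `embOfPoint_thickeningLift`, `sheet_eq_of_embOfPoint_eq`).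
[cite: SerreTate1968, §1] [cite: GortzWedhorn2020, §(4.8) and (14.20)] -/
theorem map_specialFibre_geomReductionMap_thickeningLift_eq
    [IsProper (𝒳.localise w).total.hom] [IsProper ((sheetModelOf (F := F) hinj).localise w).total.hom]
    (s : (𝒳.localise w).total ⟶ ((sheetModelOf (F := F) hinj).localise w).total)
    (hs : (genericFibre (valuationSubringAtPrime F w) F).map s ≫ ((sheetModelOf (F := F) hinj).localise w).genericIso'.hom =
      (𝒳.localise w).genericIso'.hom ≫ toSheetScheme F ((baseChange F Fi).obj X))
    (e : Fi →ₐ[F] AlgebraicClosure (w.adicCompletion F)) (y₁ y₂ : AlgPoints X (AlgebraicClosure (w.adicCompletion F))) :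
    AlgPoints.map ((specialFibreFunctor w).map s) ((𝒳.localise w).geomReductionMap (thickeningLift e X y₁)) =
      AlgPoints.map ((specialFibreFunctor w).map s) ((𝒳.localise w).geomReductionMap (thickeningLift e X y₂)) := by
  rw [← geomReductionMap_map _ _ s (toSheetScheme F ((baseChange F Fi).obj X)) hs,
    ← geomReductionMap_map _ _ s (toSheetScheme F ((baseChange F Fi).obj X)) hs]
  change ((sheetModelOf (F := F) hinj).localise w).geomReductionMap (genericSheet (thickeningLift e X y₁)) =
    ((sheetModelOf (F := F) hinj).localise w).geomReductionMap (genericSheet (thickeningLift e X y₂))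
  congr 1
  apply sheet_eq_of_embOfPoint_eq
  rw [embOfPoint_genericSheet, embOfPoint_genericSheet, embOfPoint_thickeningLift, embOfPoint_thickeningLift]

/-- **`.left` currency**: equal images under `s_s` give equal composites `x̄ ≫ ι_s ≫ s` (`ι_s : 𝓨_s → 𝓨` the special-fibre inclusion `pr₁`; Mathlib
`pullback.lift_fst` for `(s_s).left ≫ ι_s = ι_s ≫ s.left`). [cite: GortzWedhorn2020, §(4.8) and (14.20)] [cite: Hartshorne1977, II Thm. 3.3 (p. 87)] -/
theorem left_comp_fst_comp_eq_of_map_specialFibre_eq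
    (s : (𝒳.localise w).total ⟶ ((sheetModelOf (F := F) hinj).localise w).total)
    (x₁ x₂ : AlgPoints (𝒳.localise w).reductionAt (geomResidueField w))
    (h : AlgPoints.map ((specialFibreFunctor w).map s) x₁ = AlgPoints.map ((specialFibreFunctor w).map s) x₂) :
    x₁.left ≫ pullback.fst (𝒳.localise w).total.hom (specResidueField w) ≫ s.left =
      x₂.left ≫ pullback.fst (𝒳.localise w).total.hom (specResidueField w) ≫ s.left := by
  have h1 : ((specialFibreFunctor w).map s).left ≫ pullback.fst ((sheetModelOf (F := F) hinj).localise w).total.hom (specResidueField w) =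
      pullback.fst (𝒳.localise w).total.hom (specResidueField w) ≫ s.left :=
    pullback.lift_fst _ _ _
  have h2 := congrArg (fun x : AlgPoints (((sheetModelOf (F := F) hinj).localise w).reductionAt) (geomResidueField w) =>
    x.left ≫ pullback.fst ((sheetModelOf (F := F) hinj).localise w).total.hom (specResidueField w)) h
  simp only [AlgPoints.map_apply, Over.comp_left, Category.assoc, h1] at h2
  exact h2

end Abstract

/-! ### §2 The `𝓞 Fᵢ`-structure of the localised model through a STAGE sheet structure is such a morphism -/

section Stage

variable {F Fi : Type} [Field F] [NumberField F] [Field Fi] [NumberField Fi] [Algebra F Fi]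
  (X : SchemeOver F) (𝒳 : IntegralModel (𝓞 F) F ((thickening F Fi).obj X)) (w : HeightOneSpectrum (𝓞 F))
  (t : Idx (nonZeroDivisors (𝓞 F)))
  (h : 𝒳.total ⊗ (baseDiagram (nonZeroDivisors (𝓞 F))).obj t ⟶ specOver (𝓞 F) (𝓞 Fi) ⊗ (baseDiagram (nonZeroDivisors (𝓞 F))).obj t)
  (τ : specOver (𝓞 F) (valuationSubringAtPrime F w) ⟶ (baseDiagram (nonZeroDivisors (𝓞 F))).obj t)

/-- **The localised sheet morphism of a stage sheet structure EXISTS**: `σ := ((𝒳 ◁ τ) ≫ h ≫ pr₁, pr₂) : 𝓨 = 𝒳 ⊗ 𝒪_{F,(w)} → Spec 𝓞 Fᵢ ⊗ 𝒪_{F,(w)}` is a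
morphism of `𝒪_{F,(w)}`-schemes from `(𝒳.localise w).total` to the total space of the localised ★ sheet model of `𝓞 Fᵢ`, characterised by its first
coordinate `σ ≫ pr₁ = (𝒳 ◁ τ) ≫ h ≫ pr₁` (Mathlib `pullback.lift`; the structure-map identity is `Over.w` of the `𝓞 F`-morphism `(𝒳 ◁ τ) ≫ h ≫ pr₁`).
[cite: GortzWedhorn2020, Prop. 4.16 and §(4.8)] [cite: Hartshorne1977, II Thm. 3.3 (p. 87)] -/
theorem exists_sheetHom_of_stage :
    ∃ s : (𝒳.localise w).total ⟶
        ((sheetModelOf (F := F) (B := 𝓞 Fi) (L := Fi) (FaithfulSMul.algebraMap_injective (𝓞 Fi) Fi)).localise w).total,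
      s.left ≫ pullback.fst _ _ = (𝒳.total ◁ τ).left ≫ h.left ≫
        pullback.fst (specOver (𝓞 F) (𝓞 Fi)).hom ((baseDiagram (nonZeroDivisors (𝓞 F))).obj t).hom := by
  -- the `𝓞 F`-morphism `(𝒳 ◁ τ) ≫ h ≫ pr₁` commutes with the structure maps (`Over.w`), read against `Spec 𝓞 Fᵢ ⊗ 𝒪_{F,(w)}`
  have h0 : ((𝒳.total ◁ τ) ≫ h ≫ fst (specOver (𝓞 F) (𝓞 Fi)) ((baseDiagram (nonZeroDivisors (𝓞 F))).obj t)).left ≫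
        Spec.map (CommRingCat.ofHom (algebraMap (𝓞 F) (𝓞 Fi))) =
      pullback.snd 𝒳.total.hom (specOver (𝓞 F) (valuationSubringAtPrime F w)).hom ≫
        Spec.map (CommRingCat.ofHom (algebraMap (𝓞 F) (valuationSubringAtPrime F w))) :=
    (Over.w ((𝒳.total ◁ τ) ≫ h ≫ fst (specOver (𝓞 F) (𝓞 Fi)) ((baseDiagram (nonZeroDivisors (𝓞 F))).obj t))).trans
      pullback.condition
  have hc : ((𝒳.total ◁ τ) ≫ h ≫ fst (specOver (𝓞 F) (𝓞 Fi)) ((baseDiagram (nonZeroDivisors (𝓞 F))).obj t)).left ≫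
        (sheetModelOf (F := F) (B := 𝓞 Fi) (L := Fi) (FaithfulSMul.algebraMap_injective (𝓞 Fi) Fi)).total.hom =
      pullback.snd 𝒳.total.hom (specOver (𝓞 F) (valuationSubringAtPrime F w)).hom ≫
        Spec.map (CommRingCat.ofHom (algebraMap (𝓞 F) (valuationSubringAtPrime F w))) :=
    (congrArg (((𝒳.total ◁ τ) ≫ h ≫ fst (specOver (𝓞 F) (𝓞 Fi)) ((baseDiagram (nonZeroDivisors (𝓞 F))).obj t)).left ≫ ·)
      (Category.id_comp (Spec.map (CommRingCat.ofHom (algebraMap (𝓞 F) (𝓞 Fi)))))).trans h0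
  refine ⟨Over.homMk (pullback.lift
      ((𝒳.total ◁ τ) ≫ h ≫ fst (specOver (𝓞 F) (𝓞 Fi)) ((baseDiagram (nonZeroDivisors (𝓞 F))).obj t)).left
      (pullback.snd 𝒳.total.hom (specOver (𝓞 F) (valuationSubringAtPrime F w)).hom) hc) (pullback.lift_snd _ _ _), ?_⟩
  exact pullback.lift_fst _ _ _

/-- The generic isomorphism of the ★ sheet model of `B` against the projection to `Spec B`: `e_𝓑 ≫ (Spec Fᵢ → Spec B) = pr₁` (the computation `hB1` of ★
`genericFibre_map_strHom`, named). [cite: GortzWedhorn2020, Prop. 4.16 and §(4.8)] -/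
theorem sheetModelOf_genericIso_hom_left_comp_specMap {B : Type} [CommRing B] [Algebra (𝓞 Fi) B] [Algebra B Fi] [IsScalarTower (𝓞 Fi) B Fi]
    [Algebra (𝓞 F) B] [IsScalarTower (𝓞 F) B Fi] (hinj : Function.Injective (algebraMap B Fi)) :
    (sheetModelOf (F := F) hinj).genericIso.hom.left ≫ Spec.map (CommRingCat.ofHom (algebraMap B Fi)) =
      pullback.fst (sheetModelOf (F := F) hinj).total.hom (Spec.map (CommRingCat.ofHom (algebraMap (𝓞 F) F))) := by
  haveI := isPushout_of_injective (F := F) hinj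
  change ((restrictScalarsLeftIso (A := 𝓞 F) (K := F) (trivialModel B Fi)).hom ≫
      pullback.snd (𝟙 (Spec (.of B))) (Spec.map (CommRingCat.ofHom (algebraMap B Fi)))) ≫ _ = _
  rw [Category.assoc, ← pullback.condition, Category.comp_id]
  exact restrictScalarsLeftIso_hom_fst (A := 𝓞 F) (K := F) (trivialModel B Fi)

/-- The generic isomorphism `genericIso′` of the LOCALISED ★ sheet model against the projection to `Spec B`: `e ≫ (Spec Fᵢ → Spec B) = pr₁ ≫ pr₁`
(tower isomorphism ★ `towerLeftIso_hom_fst`, then the previous lemma). [cite: GortzWedhorn2020, Prop. 4.16 and §(4.8)] [cite: SerreTate1968, §1] -/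
theorem localise_sheetModelOf_genericIso'_hom_left_comp_specMap {B : Type} [CommRing B] [Algebra (𝓞 Fi) B] [Algebra B Fi]
    [IsScalarTower (𝓞 Fi) B Fi] [Algebra (𝓞 F) B] [IsScalarTower (𝓞 F) B Fi] (hinj : Function.Injective (algebraMap B Fi)) :
    ((sheetModelOf (F := F) hinj).localise w).genericIso'.hom.left ≫ Spec.map (CommRingCat.ofHom (algebraMap B Fi)) =
      pullback.fst (pullback.snd (sheetModelOf (F := F) hinj).total.hom
          (Spec.map (CommRingCat.ofHom (algebraMap (𝓞 F) (valuationSubringAtPrime F w)))))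
        (Spec.map (CommRingCat.ofHom (algebraMap (valuationSubringAtPrime F w) F))) ≫
      pullback.fst (sheetModelOf (F := F) hinj).total.hom
          (Spec.map (CommRingCat.ofHom (algebraMap (𝓞 F) (valuationSubringAtPrime F w)))) := by
  change ((towerLeftIso (R := valuationSubringAtPrime F w) (K := F) (sheetModelOf (F := F) hinj).total).hom ≫
      (sheetModelOf (F := F) hinj).genericIso.hom.left) ≫ _ = _
  rw [Category.assoc, sheetModelOf_genericIso_hom_left_comp_specMap, towerLeftIso_hom_fst]

omit [NumberField Fi] in
/-- **The tower isomorphism carries the cone leg to the localisation leg**: `towerLeftIso ≫ (𝒳 ◁ leg_t) = pr₁ ≫ (𝒳 ◁ τ)` on underlying schemes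
(`(𝒳 ⊗ 𝒪_{F,(w)}) ⊗ F ≅ 𝒳 ⊗ F`; ★ (GS-2-core) `towerLeftIso_hom_comp_whiskerLeft_left` at the tower morphism `κ_w : Spec F → Spec 𝒪_{F,(w)}` and
`(𝒳 ◁ κ_w) ≫ (𝒳 ◁ τ) = 𝒳 ◁ leg_t`, ★ `whiskerLeft_left_comp_whiskerLeft_left_eq_leg` — morphisms into the open stage `D(t)` are unique).
[cite: GortzWedhorn2020, Prop. 4.16 and §(4.8); Cor. 10.64 (2) (p. 329)] [cite: EGAIV3, Thm. 8.8.2 (i) (p. 28)] -/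
theorem towerLeftIso_hom_comp_whiskerLeft_leg_left :
    (towerLeftIso (R := valuationSubringAtPrime F w) (K := F) 𝒳.total).hom ≫ (𝒳.total ◁ leg (nonZeroDivisors (𝓞 F)) F t).left =
      pullback.fst (pullback.snd 𝒳.total.hom (Spec.map (CommRingCat.ofHom (algebraMap (𝓞 F) (valuationSubringAtPrime F w)))))
          (Spec.map (CommRingCat.ofHom (algebraMap (valuationSubringAtPrime F w) F))) ≫ (𝒳.total ◁ τ).left := by
  let κ : specOver (𝓞 F) F ⟶ specOver (𝓞 F) (valuationSubringAtPrime F w) :=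
    Over.homMk (Spec.map (CommRingCat.ofHom (algebraMap (valuationSubringAtPrime F w) F))) specMap_algebraMap_comp
  rw [← whiskerLeft_left_comp_whiskerLeft_left_eq_leg (nonZeroDivisors (𝓞 F)) F 𝒳.total t (valuationSubringAtPrime F w) τ κ,
    ← Category.assoc, towerLeftIso_hom_comp_whiskerLeft_left 𝒳.total κ rfl]

/-- **THE GENERIC SQUARE OF THE LOCALISED SHEET MORPHISM.**  If the first coordinate of `s : 𝓨 → Spec 𝓞 Fᵢ ⊗ 𝒪_{F,(w)}` is `(𝒳 ◁ τ) ≫ h ≫ pr₁` for a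
stage sheet structure `h` with the ★ (GS-3a) generic value `(𝒳 ◁ leg_t) ≫ h ≫ pr₁ = e_𝒳 ≫ pr₂ ≫ (Spec Fᵢ → Spec 𝓞 Fᵢ)` (`hgen`, VERBATIM the second
conjunct of ★ `exists_stage_sheetStructure_thickening`), then the generic value of `s` through the two `genericIso′` is the sheet coordinate
`X ⊗_F Fᵢ → Spec Fᵢ` regarded over `F` — the hypothesis of §1 ∕ of ★ `geomReductionMap_map`.  (Two maps into `Spec Fᵢ = Spec 𝓞 Fᵢ ×_{Spec 𝓞 F} Spec F`
agree iff they agree after both projections, ★ `isPullback_specMap_of_isPushout` on ★ `isPushout_of_injective`; against `Spec 𝓞 Fᵢ` this is `hgen`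
transported by the tower lemma, against `Spec F` both sides are structure maps.) [cite: EGAIV3, Thm. 8.8.2 (i) (p. 28)]
[cite: GortzWedhorn2020, Prop. 4.16 and §(4.8)] [cite: Hartshorne1977, II Thm. 3.3 (p. 87)] -/
theorem genericFibre_map_sheetHom_comp_genericIso'
    (hgen : (𝒳.total ◁ leg (nonZeroDivisors (𝓞 F)) F t).left ≫ h.left ≫
          pullback.fst (specOver (𝓞 F) (𝓞 Fi)).hom ((baseDiagram (nonZeroDivisors (𝓞 F))).obj t).hom =
        𝒳.genericIso.hom.left ≫ pullback.snd X.hom (AbelianVariety.bcSpec F Fi) ≫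
          Spec.map (CommRingCat.ofHom (algebraMap (𝓞 Fi) Fi)))
    (s : (𝒳.localise w).total ⟶
      ((sheetModelOf (F := F) (B := 𝓞 Fi) (L := Fi) (FaithfulSMul.algebraMap_injective (𝓞 Fi) Fi)).localise w).total)
    (hsfst : s.left ≫ pullback.fst _ _ = (𝒳.total ◁ τ).left ≫ h.left ≫
        pullback.fst (specOver (𝓞 F) (𝓞 Fi)).hom ((baseDiagram (nonZeroDivisors (𝓞 F))).obj t).hom) :
    (genericFibre (valuationSubringAtPrime F w) F).map s ≫
        ((sheetModelOf (F := F) (B := 𝓞 Fi) (L := Fi) (FaithfulSMul.algebraMap_injective (𝓞 Fi) Fi)).localise w).genericIso'.hom =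
      (𝒳.localise w).genericIso'.hom ≫ toSheetScheme F ((baseChange F Fi).obj X) := by
  haveI := isPushout_of_injective (F := F) (B := 𝓞 Fi) (L := Fi) (FaithfulSMul.algebraMap_injective (𝓞 Fi) Fi)
  ext : 1
  rw [Over.comp_left, Over.comp_left, toSheetScheme_left]
  apply (isPullback_specMap_of_isPushout (A := 𝓞 F) (K := F) (B := 𝓞 Fi) (L := Fi)).hom_ext
  · -- against the projection to `Spec 𝓞 Fᵢ`: `hgen` through the tower
    have S1 : ((genericFibre (valuationSubringAtPrime F w) F).map s).left ≫
        pullback.fst (pullback.snd (sheetModelOf (F := F) (B := 𝓞 Fi) (L := Fi) (FaithfulSMul.algebraMap_injective (𝓞 Fi) Fi)).total.hom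
            (Spec.map (CommRingCat.ofHom (algebraMap (𝓞 F) (valuationSubringAtPrime F w)))))
          (Spec.map (CommRingCat.ofHom (algebraMap (valuationSubringAtPrime F w) F))) =
        pullback.fst (pullback.snd 𝒳.total.hom (Spec.map (CommRingCat.ofHom (algebraMap (𝓞 F) (valuationSubringAtPrime F w)))))
          (Spec.map (CommRingCat.ofHom (algebraMap (valuationSubringAtPrime F w) F))) ≫ s.left :=
      baseChange_map_left_comp_fst s
    have R1 : (𝒳.localise w).genericIso'.hom.left =
        (towerLeftIso (R := valuationSubringAtPrime F w) (K := F) 𝒳.total).hom ≫ 𝒳.genericIso.hom.left := rfl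
    have R2 : (𝒳.localise w).genericIso'.hom.left ≫ ((baseChange F Fi).obj X).hom ≫
          Spec.map (CommRingCat.ofHom (algebraMap (𝓞 Fi) Fi)) =
        (towerLeftIso (R := valuationSubringAtPrime F w) (K := F) 𝒳.total).hom ≫
          (𝒳.total ◁ leg (nonZeroDivisors (𝓞 F)) F t).left ≫ h.left ≫
            pullback.fst (specOver (𝓞 F) (𝓞 Fi)).hom ((baseDiagram (nonZeroDivisors (𝓞 F))).obj t).hom := by
      rw [hgen, R1, Category.assoc]
      rfl
    rw [Category.assoc, localise_sheetModelOf_genericIso'_hom_left_comp_specMap, reassoc_of% S1, hsfst, Category.assoc, R2,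
      ← Category.assoc (towerLeftIso _).hom, towerLeftIso_hom_comp_whiskerLeft_leg_left X 𝒳 w t τ, Category.assoc]
  · -- against the projection to `Spec F`: structure maps
    have L1 : ((sheetModelOf (F := F) (B := 𝓞 Fi) (L := Fi) (FaithfulSMul.algebraMap_injective (𝓞 Fi) Fi)).localise w).genericIso'.hom.left ≫
        Spec.map (CommRingCat.ofHom (algebraMap F Fi)) =
        ((genericFibre (valuationSubringAtPrime F w) F).obj
          (((sheetModelOf (F := F) (B := 𝓞 Fi) (L := Fi) (FaithfulSMul.algebraMap_injective (𝓞 Fi) Fi)).localise w).total)).hom := by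
      have hw := Over.w ((sheetModelOf (F := F) (B := 𝓞 Fi) (L := Fi)
        (FaithfulSMul.algebraMap_injective (𝓞 Fi) Fi)).localise w).genericIso'.hom
      have h' : (SchemeOver.restrictScalars F (Over.mk (𝟙 (Spec (.of Fi))))).hom = Spec.map (CommRingCat.ofHom (algebraMap F Fi)) := by
        change 𝟙 _ ≫ _ = _
        exact Category.id_comp _
      rw [h'] at hw
      exact hw
    have L2 : (𝒳.localise w).genericIso'.hom.left ≫ ((baseChange F Fi).obj X).hom ≫ Spec.map (CommRingCat.ofHom (algebraMap F Fi)) =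
        ((genericFibre (valuationSubringAtPrime F w) F).obj (𝒳.localise w).total).hom :=
      Over.w (𝒳.localise w).genericIso'.hom
    rw [Category.assoc, L1, Over.w, Category.assoc, L2]

/-! ### §3 HEAD: the special points of ONE reading have the same `𝓞 Fᵢ`-structure through the stage sheet structure -/

/-- **HEAD (G4) — ONE READING, ONE `𝓞 Fᵢ`-STRUCTURE AT THE STAGE.**  For a global model `𝒳` of `X ⊗_F Fᵢ` regarded over `F`, proper at `w`, a stage
sheet structure `h : 𝒳 ⊗ D(t) → Spec 𝓞 Fᵢ ⊗ D(t)` with the ★ (GS-3a) generic value (`hgen`) and a localisation leg `τ : Spec 𝒪_{F,(w)} → D(t)`: for every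
`F`-embedding `e : Fᵢ → Ω̄_w` and all `y₁, y₂ ∈ X(Ω̄_w)`, the special points `x̄ᵢ := red_𝓨 (ℓ_e yᵢ)` of `𝓨 = 𝒳.localise w` have the SAME composite
`x̄ᵢ ≫ ι_s ≫ (𝒳 ◁ τ) ≫ h ≫ pr₁ : Spec κ̄(w) → Spec 𝓞 Fᵢ` — in the P-line's tokens `spPt 𝓜 w (red₀Of … e yᵢ) ≫ stageLocLeg 𝓜 w t τ ≫ h.left ≫ pr₁`,
the «same structure map `y₁ ≫ q = y₂ ≫ q`» slot of ★ (GS-3) for the stage family read per sheet (§2 + §1).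
[cite: SerreTate1968, §1] [cite: EGAIV3, Thm. 8.8.2 (i) (p. 28)] [cite: MumfordFogartyKirwan1994, Ch. 7 §2 Definition 7.2 (p. 129)]
[cite: GortzWedhorn2020, §(4.8) and (14.20)] -/
theorem specialPoint_stageSheet_eq [IsProper (𝒳.localise w).total.hom]
    (hgen : (𝒳.total ◁ leg (nonZeroDivisors (𝓞 F)) F t).left ≫ h.left ≫
          pullback.fst (specOver (𝓞 F) (𝓞 Fi)).hom ((baseDiagram (nonZeroDivisors (𝓞 F))).obj t).hom =
        𝒳.genericIso.hom.left ≫ pullback.snd X.hom (AbelianVariety.bcSpec F Fi) ≫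
          Spec.map (CommRingCat.ofHom (algebraMap (𝓞 Fi) Fi)))
    (e : Fi →ₐ[F] AlgebraicClosure (w.adicCompletion F)) (y₁ y₂ : AlgPoints X (AlgebraicClosure (w.adicCompletion F))) :
    ((𝒳.localise w).geomReductionMap (thickeningLift e X y₁)).left ≫ pullback.fst (𝒳.localise w).total.hom (specResidueField w) ≫
        (𝒳.total ◁ τ).left ≫ h.left ≫ pullback.fst (specOver (𝓞 F) (𝓞 Fi)).hom ((baseDiagram (nonZeroDivisors (𝓞 F))).obj t).hom =
      ((𝒳.localise w).geomReductionMap (thickeningLift e X y₂)).left ≫ pullback.fst (𝒳.localise w).total.hom (specResidueField w) ≫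
        (𝒳.total ◁ τ).left ≫ h.left ≫ pullback.fst (specOver (𝓞 F) (𝓞 Fi)).hom ((baseDiagram (nonZeroDivisors (𝓞 F))).obj t).hom := by
  obtain ⟨s, hsfst⟩ := exists_sheetHom_of_stage X 𝒳 w t h τ
  -- the localised sheet model of `𝓞 Fᵢ` is proper (finite)
  haveI : IsProper (sheetModelOf (F := F) (B := 𝓞 Fi) (L := Fi) (FaithfulSMul.algebraMap_injective (𝓞 Fi) Fi)).total.hom := by
    haveI := isFinite_specMap_ringOfIntegers (F := F) (Fi := Fi)
    change IsProper (𝟙 _ ≫ Spec.map (CommRingCat.ofHom (algebraMap (𝓞 F) (𝓞 Fi))))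
    infer_instance
  haveI : IsProper ((sheetModelOf (F := F) (B := 𝓞 Fi) (L := Fi) (FaithfulSMul.algebraMap_injective (𝓞 Fi) Fi)).localise w).total.hom :=
    isProper_localise_total_hom _ w
  have hs := genericFibre_map_sheetHom_comp_genericIso' X 𝒳 w t h τ hgen s hsfst
  have hm := map_specialFibre_geomReductionMap_thickeningLift_eq (FaithfulSMul.algebraMap_injective (𝓞 Fi) Fi) X 𝒳 w s hs e y₁ y₂
  have hl := left_comp_fst_comp_eq_of_map_specialFibre_eq (FaithfulSMul.algebraMap_injective (𝓞 Fi) Fi) X 𝒳 w s _ _ hm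
  have hl' := congrArg (· ≫ pullback.fst
    (sheetModelOf (F := F) (B := 𝓞 Fi) (L := Fi) (FaithfulSMul.algebraMap_injective (𝓞 Fi) Fi)).total.hom
    (Spec.map (CommRingCat.ofHom (algebraMap (𝓞 F) (valuationSubringAtPrime F w))))) hl
  simp only [Category.assoc, hsfst] at hl'
  exact hl'

/-! ### §4 The centre: a NONZERO prime of `𝓞 Fᵢ` above `w` -/

omit [NumberField Fi] in
/-- The `𝓞 Fᵢ`-structure of a special point composed to `Spec 𝓞 F` is `Spec κ̄(w) → Spec κ(w) → Spec 𝒪_{F,(w)} → Spec 𝓞 F` (`Over.w` of the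
`𝓞 F`-morphism `(𝒳 ◁ τ) ≫ h ≫ pr₁`, the two cartesian squares of `𝓨 = 𝒳 ⊗ 𝒪_{F,(w)}` and of its special fibre, and `Over.w x̄`).
[cite: GortzWedhorn2020, Prop. 4.16 and §(4.8)] [cite: Hartshorne1977, II Thm. 3.3 (p. 87)] -/
theorem specialPoint_stageSheet_comp_specMap (x : AlgPoints (𝒳.localise w).reductionAt (geomResidueField w)) :
    (x.left ≫ pullback.fst (𝒳.localise w).total.hom (specResidueField w) ≫ (𝒳.total ◁ τ).left ≫ h.left ≫
        pullback.fst (specOver (𝓞 F) (𝓞 Fi)).hom ((baseDiagram (nonZeroDivisors (𝓞 F))).obj t).hom) ≫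
        Spec.map (CommRingCat.ofHom (algebraMap (𝓞 F) (𝓞 Fi))) =
      Spec.map (CommRingCat.ofHom ((algebraMap (w.asIdeal.ResidueField) (geomResidueField w)).comp
        ((residueAt w).comp (algebraMap (𝓞 F) (valuationSubringAtPrime F w))))) := by
  have e1 : (𝒳.total ◁ τ).left ≫ h.left ≫
        pullback.fst (specOver (𝓞 F) (𝓞 Fi)).hom ((baseDiagram (nonZeroDivisors (𝓞 F))).obj t).hom ≫
        Spec.map (CommRingCat.ofHom (algebraMap (𝓞 F) (𝓞 Fi))) =
      pullback.snd 𝒳.total.hom (specOver (𝓞 F) (valuationSubringAtPrime F w)).hom ≫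
        Spec.map (CommRingCat.ofHom (algebraMap (𝓞 F) (valuationSubringAtPrime F w))) := by
    have h0 := (Over.w ((𝒳.total ◁ τ) ≫ h ≫
      fst (specOver (𝓞 F) (𝓞 Fi)) ((baseDiagram (nonZeroDivisors (𝓞 F))).obj t))).trans pullback.condition
    simp only [Over.comp_left, Category.assoc] at h0
    exact h0
  have e2 : pullback.fst (𝒳.localise w).total.hom (specResidueField w) ≫
        pullback.snd 𝒳.total.hom (specOver (𝓞 F) (valuationSubringAtPrime F w)).hom =
      pullback.snd (𝒳.localise w).total.hom (specResidueField w) ≫ specResidueField w :=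
    pullback.condition
  have e3 : x.left ≫ pullback.snd (𝒳.localise w).total.hom (specResidueField w) =
      Spec.map (CommRingCat.ofHom (algebraMap (w.asIdeal.ResidueField) (geomResidueField w))) := Over.w x
  have step1 := congrArg (fun f => x.left ≫ pullback.fst (𝒳.localise w).total.hom (specResidueField w) ≫ f) e1
  have step2 := congrArg (fun f => x.left ≫ f ≫
    Spec.map (CommRingCat.ofHom (algebraMap (𝓞 F) (valuationSubringAtPrime F w)))) e2
  have step3 := congrArg (fun f => f ≫ specResidueField w ≫
    Spec.map (CommRingCat.ofHom (algebraMap (𝓞 F) (valuationSubringAtPrime F w)))) e3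
  simp only [Category.assoc] at step1 step2 step3 ⊢
  refine step1.trans (step2.trans (step3.trans ?_))
  change Spec.map _ ≫ Spec.map _ ≫ Spec.map _ = _
  rw [← Spec.map_comp, ← Spec.map_comp, ← CommRingCat.ofHom_comp, ← CommRingCat.ofHom_comp]

omit [NumberField Fi] in
/-- **THE CENTRE OF A SPECIAL POINT AT THE STAGE IS A NONZERO PRIME OF `𝓞 Fᵢ` ABOVE `w`** (G4b): the composite
`x̄ ≫ ι_s ≫ (𝒳 ◁ τ) ≫ h ≫ pr₁ : Spec κ̄(w) → Spec 𝓞 Fᵢ` sends the point to `⟨v.asIdeal, v.isPrime⟩` for some `v : HeightOneSpectrum (𝓞 Fᵢ)` with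
`v ∩ 𝓞 F = w` (the composite to `Spec 𝓞 F` factors through `Spec κ(w) → Spec 𝒪_{F,(w)}`, kernel `𝔪_(w) ∩ 𝓞 F = w` — Mathlib
`IsLocalization.AtPrime.under_maximalIdeal`; nonzero because `𝓞 F → 𝓞 Fᵢ` is injective and `w ≠ 0`) — the `v ∉ S` slot of ★ (GS-3).
[cite: SerreTate1968, §1] [cite: GortzWedhorn2020, §(4.8) and (14.20)] -/
theorem exists_heightOneSpectrum_center_specialPoint_stageSheet (x : AlgPoints (𝒳.localise w).reductionAt (geomResidueField w)) :
    ∃ v : HeightOneSpectrum (𝓞 Fi),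
      (x.left ≫ pullback.fst (𝒳.localise w).total.hom (specResidueField w) ≫ (𝒳.total ◁ τ).left ≫ h.left ≫
          pullback.fst (specOver (𝓞 F) (𝓞 Fi)).hom ((baseDiagram (nonZeroDivisors (𝓞 F))).obj t).hom).base
        (IsLocalRing.closedPoint (geomResidueField w)) = ⟨v.asIdeal, v.isPrime⟩ ∧
      v.asIdeal.comap (algebraMap (𝓞 F) (𝓞 Fi)) = w.asIdeal := by
  obtain ⟨p, hp⟩ : ∃ p : PrimeSpectrum (𝓞 Fi),
      (x.left ≫ pullback.fst (𝒳.localise w).total.hom (specResidueField w) ≫ (𝒳.total ◁ τ).left ≫ h.left ≫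
          pullback.fst (specOver (𝓞 F) (𝓞 Fi)).hom ((baseDiagram (nonZeroDivisors (𝓞 F))).obj t).hom).base
        (IsLocalRing.closedPoint (geomResidueField w)) = p := ⟨_, rfl⟩
  -- the prime under `p` is `w`
  have hker : RingHom.ker ((algebraMap (w.asIdeal.ResidueField) (geomResidueField w)).comp
      ((residueAt w).comp (algebraMap (𝓞 F) (valuationSubringAtPrime F w)))) = w.asIdeal := by
    rw [← RingHom.comap_ker, (RingHom.injective_iff_ker_eq_bot _).mp
        (algebraMap (w.asIdeal.ResidueField) (geomResidueField w)).injective,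
      ← RingHom.ker_eq_comap_bot, ← RingHom.comap_ker, ker_residueAt]
    exact IsLocalization.AtPrime.under_maximalIdeal (valuationSubringAtPrime F w) w.asIdeal
  have hunder : p.asIdeal.comap (algebraMap (𝓞 F) (𝓞 Fi)) = w.asIdeal := by
    have h1 := congrArg
      (fun f : ((specOver (w.asIdeal.ResidueField) (geomResidueField w)).left ⟶ Spec (.of (𝓞 F))) =>
        f.base (IsLocalRing.closedPoint (geomResidueField w)))
      (specialPoint_stageSheet_comp_specMap X 𝒳 w t h τ x)
    have h2 : p.asIdeal.comap (algebraMap (𝓞 F) (𝓞 Fi)) =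
        (((x.left ≫ pullback.fst (𝒳.localise w).total.hom (specResidueField w) ≫ (𝒳.total ◁ τ).left ≫ h.left ≫
            pullback.fst (specOver (𝓞 F) (𝓞 Fi)).hom ((baseDiagram (nonZeroDivisors (𝓞 F))).obj t).hom) ≫
            Spec.map (CommRingCat.ofHom (algebraMap (𝓞 F) (𝓞 Fi)))).base (IsLocalRing.closedPoint (geomResidueField w))).asIdeal := by
      rw [← hp]
      rfl
    rw [h2]
    simp only at h1
    rw [h1]
    change Ideal.comap _ (IsLocalRing.closedPoint (geomResidueField w)).asIdeal = w.asIdeal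
    rw [show (IsLocalRing.closedPoint (geomResidueField w)).asIdeal = ⊥ from Ideal.eq_bot_of_prime _, ← RingHom.ker_eq_comap_bot]
    exact hker
  have hne : p.asIdeal ≠ ⊥ := by
    intro h0
    apply w.ne_bot
    rw [← hunder, h0, Ideal.comap_bot_of_injective]
    exact fun a b hab => FaithfulSMul.algebraMap_injective (𝓞 F) Fi
      (by rw [IsScalarTower.algebraMap_apply (𝓞 F) (𝓞 Fi) Fi, IsScalarTower.algebraMap_apply (𝓞 F) (𝓞 Fi) Fi, hab])
  exact ⟨⟨p.asIdeal, p.isPrime, hne⟩, hp, hunder⟩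

/-! ### §5 Special points are recovered from their images in the stage (★ G3 + ★ `reductionAt_point_ext`) -/

omit [NumberField Fi] [Algebra F Fi] in
/-- **SPECIAL POINTS ARE RECOVERED FROM THEIR IMAGES IN THE STAGE**: if `x̄₁ ≫ ι_s ≫ (𝒳 ◁ τ) = x̄₂ ≫ ι_s ≫ (𝒳 ◁ τ)` (equal `κ̄(w)`-points of the stage
`𝒳 ⊗ D(t)`, i.e. `spPt x̄₁ ≫ stageLocLeg = spPt x̄₂ ≫ stageLocLeg` in the P-line's tokens) then `x̄₁ = x̄₂`: the localisation leg is injective on points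
(★ (G3) `whiskerLeft_left_comp_injective_of_isLocalization` at the localisation `𝒪_{F,(w)} = (𝓞 F)_w`), and a special point is determined by its image in the
global total space (★ `reductionAt_point_ext`). [cite: GortzWedhorn2020, Cor. 10.64 (2) (p. 329)] [cite: Hartshorne1977, II Thm. 3.3 (p. 87)] [cite: SerreTate1968, §1] -/
theorem reductionAt_point_eq_of_comp_whiskerLeft_eq {X : SchemeOver F} (𝒳 : IntegralModel (𝓞 F) F X)
    (x₁ x₂ : AlgPoints (𝒳.localise w).reductionAt (geomResidueField w))
    (hx : x₁.left ≫ pullback.fst (𝒳.localise w).total.hom (specResidueField w) ≫ (𝒳.total ◁ τ).left =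
      x₂.left ≫ pullback.fst (𝒳.localise w).total.hom (specResidueField w) ≫ (𝒳.total ◁ τ).left) :
    x₁ = x₂ := by
  have h1 : x₁.left ≫ pullback.fst (𝒳.localise w).total.hom (specResidueField w) =
      x₂.left ≫ pullback.fst (𝒳.localise w).total.hom (specResidueField w) :=
    Limits.LocApprox.whiskerLeft_left_comp_injective_of_isLocalization w.asIdeal.primeCompl (valuationSubringAtPrime F w)
      𝒳.total τ _ _ (by simpa only [Category.assoc] using hx)
  exact reductionAt_point_ext 𝒳 w x₁ x₂ (by simp only [← Category.assoc, h1])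

end Stage

end Literature.AlgebraicGeometry.Motives.IntegralModel

end
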